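import Summits.HubbardSuperconductivity.HubbardSuperconductivity.Theorems.AnisotropyChordStiffnessCompressibility
import Summits.HubbardSuperconductivity.HubbardSuperconductivity.Theorems.AnisotropyChordInsertionEntropyInfrared
import Summits.HubbardSuperconductivity.HubbardSuperconductivity.Theorems.AnisotropyChordInsertionEntropyGroundStateDeconfinement

/-!
# Route `AnisotropyChord` / H0 rotor rung: THE H0 RESIDUAL AS A NAMED FRONTIER CONJECTURE «(S) + (K) + (Λ) ⇒
# teleportation deconfinement of the ground states» (port of theory seat `hubbard-h0-rotor-theory-1`, cycle 10, Part L,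
# memo ROTOR-THEORY-10 §140, §143, §146 (B))

Everything downstream of `GroundStateTeleDeconfined` is a tree theorem (`eventualCondensate_of_groundStateTeleDeconfined`,
p631063); everything upstream — the audited hypotheses (S) `UniformHelicityTensor`, (K) `UniformSusceptibility` and
the Landau hypothesis (Λ_α) `LandauGapBound` — is typed.  The residual content of H0 in the rotor class is therefore
ONE implication, typed here as `H0Residual Δ M`; it needs the Landau/irreducibility input (Λ) because without it the
model-independent wording is refuted by the sliding-phase arrays of cycle 1 (memo §140 (k)).  `eventualCondensate_of_residual`
is the bridge: H0Residual + (S) + (K) + (Λ) ⇒ `EventualCondensate`.  Recommended ledger placement: FRONTIER conjecture /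
conditional bridge (summit-class in the typed hard-core family: it contains «BEC for the XXZ ground state off the
reflection-positive point»).
-/

set_option linter.dupNamespace false

noncomputable section

open Filter Topology
open Literature.MathematicalPhysics.QuantumLattice hiding torusPhase torusNorm
open Literature.Probability.LatticeModels
open Summit.HubbardSuperconductivity.HubbardSuperconductivity.Theorems.AnisotropyChord.Stiffness

namespace Summit.HubbardSuperconductivity.HubbardSuperconductivity.Theorems.AnisotropyChord.InsertionEntropy

/-- **FRONTIER CONJECTURE H0res (typed).**  For the hard-core boson / XXZ(Δ) Perron sector ground states along the
sector sequence `M_L`: uniform helicity tensor (S) + uniform susceptibility (K) + Landau gap bound (Λ_α) ⇒ the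
teleportation log-loss of the ground amplitudes is bounded below uniformly in `L` (`GroundStateTeleDeconfined`).
[conjecture: theory seat hubbard-h0-rotor-theory-1, cycle 10, 2026-08-28 — memo ROTOR-THEORY-10 §140/§143; OPEN,
summit-class in this family] -/
def H0Residual (Δ : ℝ) (M : ℕ → ℝ) : Prop :=
  UniformHelicityTensor Δ M → UniformSusceptibility Δ M → LandauGapBound Δ M → GroundStateTeleDeconfined Δ M

/-- **The bridge**: the residual conjecture plus the three audited/typed hypotheses give eventual condensation
(everything else is in the tree). [new: theory seat hubbard-h0-rotor-theory-1, cycle 10, 2026-08-28] -/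
theorem eventualCondensate_of_residual (Δ : ℝ) (M : ℕ → ℝ) (ρ : ℝ) (hρ : ρ ∈ Set.Ioo (0 : ℝ) 1)
    (hlim : Tendsto (fun L : ℕ => 1 / 2 + M L / (L : ℝ) ^ 2) atTop (𝓝 ρ))
    (hres : H0Residual Δ M) (hS : UniformHelicityTensor Δ M) (hK : UniformSusceptibility Δ M)
    (hΛ : LandauGapBound Δ M) : EventualCondensate Δ M :=
  eventualCondensate_of_groundStateTeleDeconfined Δ M ρ hρ hlim (hres hS hK hΛ)

end Summit.HubbardSuperconductivity.HubbardSuperconductivity.Theorems.AnisotropyChord.InsertionEntropy
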